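import Mathlib
import Summits.Ventures.HodgeRepro.Tier4.Target
import Summits.Ventures.HodgeRepro.Tier4.Line3.Defs
import Summits.Ventures.HodgeRepro.Tier4.Line3.DefsLemmas
import Summits.Ventures.HodgeRepro.Tier4.Line3.GaussRatioFormula
import Summits.Ventures.HodgeRepro.Tier4.Line3.CopyWeightGaussian
import Summits.Ventures.HodgeRepro.Tier4.Line3.CopyCountShrink
import Summits.Ventures.HodgeRepro.Tier4.Line3.ShrinkMajGauss
import Summits.Ventures.HodgeRepro.Tier4.Line3.QuarticProfile
import Summits.Ventures.HodgeRepro.Tier4.Line3.RatioWindow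
import Summits.Ventures.HodgeRepro.Tier4.Line3.WindowCentre
import Summits.Ventures.HodgeRepro.Tier4.Line3.MixedDensity

/-!
# Tier4/Line3/ProfileWindowReach — the near-equal profile window is reached from every centre, in every degree

Blind re-derivation cell `pub-hodge-repro`, Tier 4 «PROVE THE STEP», LINE L3, seat t4-L3-p2 (g3): pieces (2)–(3) of
C-L3-GENREACH (STATUS S14746 / S14748). The line's any-degree display (skeleton II-u, v0.51 →) asks of the centre the
near-equal profile window `ProfileWindow κ xm`: at every slot the half `τ₀`-size and every definite size lie within ratio
`1 + κ` of each other. A scalar `λ` on a slot `x` scales the `τ₀`-size by `‖τ₀ λ‖²` (`tauSize_smul`) and the definite size at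
`σ` by `‖σ λ‖²` (`defQuad_smul`); by the density of `E` in its mixed space (`MixedDensity.exists_ne_zero_sq_place_mem_Ioo`)
the sizes `(w λ)²` at the complex places can be prescribed up to any ratio `ρ > 1` — targets `2 / tauSize x` at the place of
`τ₀` and `1 / defQuad σ x` at the place of `σ` put every size of `λ • x` in `(1/ρ, ρ)` (`exists_scalar_sizes_near_one`), and
`ρ = 1 + min κ 3 / 3` has `ρ² ≤ 1 + κ`, so the slot is in the window with `a = 1/ρ` (`exists_scalar_profileWindow_slot`).
With `λ₂ = λ₀`, `λ₃ = λ₁` the symmetry and the four centre clauses are kept (WindowCentre): `exists_profileWindow_reach`, the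
statement the line's planner binds (S14748) — no unit, no covering radius, no field inequality, every degree.

Nothing here says anything about the status of the Hodge conjecture for CM abelian varieties, which is NOT proved
(HC_CM is NOT proved by anyone in this repository).
-/

set_option autoImplicit false

noncomputable section

namespace Summit.Ventures.HodgeRepro.Tier4.Line3

open Summit.Ventures.HodgeRepro.Tier4
open Matrix NumberField NumberField.InfinitePlace
open scoped ComplexConjugate
open scoped Classical

namespace T4Data

variable (X : T4Data)

/-! ## A. Places and the definite embeddings -/

/-- The embedding chosen by a place other than the place of `τ₀` is definite. -/
theorem embedding_mem_defEmb_of_ne {w : InfinitePlace X.E} (hw : w ≠ InfinitePlace.mk X.τ₀) :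
    w.embedding ∈ X.defEmb := by
  simp only [defEmb, Finset.mem_filter, Finset.mem_univ, true_and]
  constructor
  · intro h
    apply hw
    rw [← mk_embedding w, h]
  · intro h
    apply hw
    rw [← mk_embedding w, h, X.conjEmb_tau_eq_conjugate, mk_conjugate_eq]

/-- The place of a definite embedding is not the place of `τ₀`. -/
theorem mk_ne_mk_tau_of_mem_defEmb {σ : X.E →+* ℂ} (hσ : σ ∈ X.defEmb) :
    InfinitePlace.mk σ ≠ InfinitePlace.mk X.τ₀ := by
  have hσ' : σ ≠ X.τ₀ ∧ σ ≠ conjEmb X.τ₀ := by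
    simpa only [defEmb, Finset.mem_filter, Finset.mem_univ, true_and] using hσ
  intro h
  rcases mk_eq_iff.1 h with h1 | h1
  · exact hσ'.1 h1
  · apply hσ'.2
    rw [X.conjEmb_tau_eq_conjugate, ← h1]
    ext x
    rw [ComplexEmbedding.conjugate_coe_eq, ComplexEmbedding.conjugate_coe_eq, Complex.conj_conj]

/-- The definite size at the embedding chosen by the place of `σ` is the definite size at `σ`. -/
theorem defQuad_embedding_mk {σ : X.E →+* ℂ} (x : Fin 3 → X.E) :
    X.defQuad (InfinitePlace.mk σ).embedding x = X.defQuad σ x := by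
  rcases mk_eq_iff.1 (mk_embedding (InfinitePlace.mk σ)) with h | h
  · rw [h]
  · have h' : (InfinitePlace.mk σ).embedding = conjEmb σ := by
      ext y
      have := congrArg (fun φ : X.E →+* ℂ => conj (φ y)) h
      simp only [ComplexEmbedding.conjugate_coe_eq, Complex.conj_conj] at this
      exact this
    rw [h', X.defQuad_conjEmb]

/-! ## B. The sizes of one slot can be put near `1` by a scalar -/

/-- **ALL SIZES OF A SLOT NEAR `1`**: for `x ≠ 0` and `ρ > 1` there is `λ ≠ 0` with the half `τ₀`-size and every
definite size of `λ • x` in `(1/ρ, ρ)`. -/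
theorem exists_scalar_sizes_near_one {x : Fin 3 → X.E} (hx : x ≠ 0) {ρ : ℝ} (hρ : 1 < ρ) :
    ∃ lam : X.E, lam ≠ 0 ∧ 1 / ρ < X.tauSize (lam • x) / 2 ∧ X.tauSize (lam • x) / 2 < ρ ∧
      ∀ σ ∈ X.defEmb, 1 / ρ < X.defQuad σ (lam • x) ∧ X.defQuad σ (lam • x) < ρ := by
  have hρ0 : 0 < ρ := by linarith
  have hh : 0 < X.tauSize x := X.tauSize_pos hx
  let c : {w : InfinitePlace X.E // IsComplex w} → ℝ := fun w =>
    if w.1 = InfinitePlace.mk X.τ₀ then 2 / X.tauSize x else 1 / X.defQuad w.1.embedding x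
  have hc : ∀ w, 0 < c w := by
    intro w
    simp only [c]
    split_ifs with hw
    · positivity
    · have := X.defQuad_pos (X.embedding_mem_defEmb_of_ne hw) hx
      positivity
  obtain ⟨lam, hlam, hsize⟩ := exists_ne_zero_sq_place_mem_Ioo X.E c hc hρ
  refine ⟨lam, hlam, ?_, ?_, ?_⟩
  · -- the place of `τ₀`
    have h := (hsize ⟨InfinitePlace.mk X.τ₀, IsTotallyComplex.isComplex _⟩).1
    simp only [c, if_true, InfinitePlace.apply] at h
    rw [X.tauSize_smul]
    rw [div_lt_iff₀ hρ0] at h ⊢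
    rw [div_lt_iff₀ hh] at h
    nlinarith
  · have h := (hsize ⟨InfinitePlace.mk X.τ₀, IsTotallyComplex.isComplex _⟩).2
    simp only [c, if_true, InfinitePlace.apply] at h
    rw [X.tauSize_smul]
    rw [div_mul_eq_mul_div, lt_div_iff₀ hh] at h
    nlinarith
  · intro σ hσ
    have hne := X.mk_ne_mk_tau_of_mem_defEmb hσ
    have h := hsize ⟨InfinitePlace.mk σ, IsTotallyComplex.isComplex _⟩
    simp only [c, if_neg hne, InfinitePlace.apply, X.defQuad_embedding_mk] at h
    have hq : 0 < X.defQuad σ x := X.defQuad_pos hσ hx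
    rw [X.defQuad_smul]
    obtain ⟨h1, h2⟩ := h
    constructor
    · rw [div_lt_iff₀ hρ0] at h1 ⊢
      rw [div_lt_iff₀ hq] at h1
      nlinarith
    · rw [div_mul_eq_mul_div, lt_div_iff₀ hq] at h2
      nlinarith

/-- **ONE SLOT IN THE NEAR-EQUAL WINDOW**: for `x ≠ 0` and `κ > 0` there is `λ ≠ 0` with `a ≤ tauSize (λ • x)/2 ≤ (1 + κ) a`
and `a ≤ defQuad σ (λ • x) ≤ (1 + κ) a` at every definite `σ`, for some `a > 0`. -/
theorem exists_scalar_profileWindow_slot {x : Fin 3 → X.E} (hx : x ≠ 0) {κ : ℝ} (hκ : 0 < κ) :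
    ∃ lam : X.E, lam ≠ 0 ∧ ∃ a : ℝ, 0 < a ∧ a ≤ X.tauSize (lam • x) / 2 ∧ X.tauSize (lam • x) / 2 ≤ (1 + κ) * a ∧
      ∀ σ ∈ X.defEmb, a ≤ X.defQuad σ (lam • x) ∧ X.defQuad σ (lam • x) ≤ (1 + κ) * a := by
  set m : ℝ := min κ 3 with hm
  have hm0 : 0 < m := lt_min hκ (by norm_num)
  have hmκ : m ≤ κ := min_le_left _ _
  have hm3 : m ≤ 3 := min_le_right _ _
  set ρ : ℝ := 1 + m / 3 with hρ
  have hρ1 : 1 < ρ := by rw [hρ]; linarith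
  have hρ0 : 0 < ρ := by linarith
  -- `ρ² ≤ 1 + κ`
  have hρsq : ρ * ρ ≤ 1 + κ := by rw [hρ]; nlinarith
  obtain ⟨lam, hlam, hτ1, hτ2, hdef⟩ := X.exists_scalar_sizes_near_one hx hρ1
  refine ⟨lam, hlam, 1 / ρ, by positivity, hτ1.le, ?_, fun σ hσ => ⟨(hdef σ hσ).1.le, ?_⟩⟩
  · calc X.tauSize (lam • x) / 2 ≤ ρ := hτ2.le
      _ ≤ (1 + κ) * (1 / ρ) := by
        rw [mul_one_div, le_div_iff₀ hρ0]
        exact hρsq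
  · calc X.defQuad σ (lam • x) ≤ ρ := (hdef σ hσ).2.le
      _ ≤ (1 + κ) * (1 / ρ) := by
        rw [mul_one_div, le_div_iff₀ hρ0]
        exact hρsq

/-! ## C. The centre in the window, with the four clauses -/

/-- **C-L3-GENREACH**: in every degree, from every symmetric `J`-positive centre with wedge `≠ 0` and `gram 0 1 ≠ 0`, for
every `κ > 0`, a symmetric scaling `xm' j = λ j • xm j` (`λ₂ = λ₀`, `λ₃ = λ₁`) keeps the four clauses and lies in the
near-equal profile window of width `κ` at every slot. -/
theorem exists_profileWindow_reach {κ : ℝ} (hκ : 0 < κ) {xm : X.Tuple} (h02 : xm 2 = xm 0) (h13 : xm 3 = xm 1)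
    (hab : X.ballCoord (xm 0) 0 * X.ballCoord (xm 1) 1 - X.ballCoord (xm 0) 1 * X.ballCoord (xm 1) 0 ≠ 0)
    (hpos : ∀ u v : ℂ, (u ≠ 0 ∨ v ≠ 0) →
      0 < (star (u • X.ballCoord (xm 0) + v • X.ballCoord (xm 1)) ⬝ᵥ
        (J *ᵥ (u • X.ballCoord (xm 0) + v • X.ballCoord (xm 1)))).re)
    (hB : X.gram xm 0 1 ≠ 0) :
    ∃ (lam : Fin 4 → X.E) (xm' : X.Tuple), (∀ j, lam j ≠ 0) ∧ lam 2 = lam 0 ∧ lam 3 = lam 1 ∧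
      (∀ j, xm' j = lam j • xm j) ∧ xm' 2 = xm' 0 ∧ xm' 3 = xm' 1 ∧
      X.ballCoord (xm' 0) 0 * X.ballCoord (xm' 1) 1 - X.ballCoord (xm' 0) 1 * X.ballCoord (xm' 1) 0 ≠ 0 ∧
      (∀ u v : ℂ, (u ≠ 0 ∨ v ≠ 0) →
        0 < (star (u • X.ballCoord (xm' 0) + v • X.ballCoord (xm' 1)) ⬝ᵥ
          (J *ᵥ (u • X.ballCoord (xm' 0) + v • X.ballCoord (xm' 1)))).re) ∧
      X.gram xm' 0 1 ≠ 0 ∧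
      ∀ j, ∃ a : ℝ, 0 < a ∧ a ≤ X.tauSize (xm' j) / 2 ∧ X.tauSize (xm' j) / 2 ≤ (1 + κ) * a ∧
        ∀ σ ∈ X.defEmb, a ≤ X.defQuad σ (xm' j) ∧ X.defQuad σ (xm' j) ≤ (1 + κ) * a := by
  have hx0 : xm 0 ≠ 0 := X.ne_zero_of_wedge hab
  have hx1 : xm 1 ≠ 0 := X.slot1_ne_zero_of_wedge hab
  obtain ⟨l0, hl0, hw0⟩ := X.exists_scalar_profileWindow_slot hx0 hκ
  obtain ⟨l1, hl1, hw1⟩ := X.exists_scalar_profileWindow_slot hx1 hκ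
  set lam : Fin 4 → X.E := ![l0, l1, l0, l1] with hlam
  set xm' : X.Tuple := fun j => lam j • xm j with hxm'
  have e0 : xm' 0 = l0 • xm 0 := rfl
  have e1 : xm' 1 = l1 • xm 1 := rfl
  have e2 : xm' 2 = l0 • xm 0 := by
    show l0 • xm 2 = l0 • xm 0
    rw [h02]
  have e3 : xm' 3 = l1 • xm 1 := by
    show l1 • xm 3 = l1 • xm 1
    rw [h13]
  have hlamne : ∀ j, lam j ≠ 0 := by
    intro j
    match j with
    | 0 => exact hl0
    | 1 => exact hl1
    | 2 => exact hl0
    | 3 => exact hl1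
  refine ⟨lam, xm', hlamne, rfl, rfl, fun j => rfl, e2.trans e0.symm, e3.trans e1.symm, ?_, ?_, ?_, ?_⟩
  · rw [e0, e1]
    exact X.wedge_scaled_ne hl0 hl1 hab
  · rw [e0, e1]
    exact X.jpos_scaled hl0 hl1 hpos
  · exact X.gram_scaled_ne hl0 hl1 e0 e1 hB
  · intro j
    match j with
    | 0 => rw [e0]; exact hw0
    | 1 => rw [e1]; exact hw1
    | 2 => rw [e2]; exact hw0
    | 3 => rw [e3]; exact hw1

end T4Data

end Summit.Ventures.HodgeRepro.Tier4.Line3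

end
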